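import Literature.InformationTheory.QuantumCodes.CSSPhenomenologicalThreshold
import Literature.InformationTheory.QuantumCodes.CSSErasureThreshold
import Literature.InformationTheory.QuantumCodes.CSSMixedChannelThreshold
import Literature.InformationTheory.QuantumCodes.SyndromeDecodingCSS
import Literature.InformationTheory.QuantumCodes.BivariateBicycleCodes
import HarnessLib

/-!
# Finite-size logical-error bounds for a single CSS code (Dumer–Kovalev–Pryadko cluster expansion)
# and for the bivariate-bicycle codes `QC(A, B)` (check weight `6`)

Topic `Literature/InformationTheory/QuantumCodes` (venture QEC, LADDER-QEC rung Q5, finite-size companion of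
the threshold files; qec-lit-2 gen 3). PROVED, no named fact, kernel axioms. The cluster-expansion bound of
Dumer–Kovalev–Pryadko (eq. (min-E-condition) with the CSS count (upper-bound-Nm-CSS): "the probability to
encounter a bad error … `Σ_{m ≥ d} N_m P_m`", `N_m ≤ n (w-1)^{m-1}`) is a FINITE-SIZE statement about one
code: for a CSS code in the tree's `CSSCode` vocabulary, one error type (`Z`-errors: detected by `H^X`,
syndrome `zSyndrome`, undetectable set `ker H^X`, trivial set `rs H^Z`, distance `d^Z`), checks of weight
`≤ w`, EVERY minimum-weight decoder and independent errors of rate `p ≤ 1/2`: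
`P_fail ≤ n · (2(w-1)s)^{d^Z} / ((w-1)(1 - 2(w-1)s))`, `s = √(p(1-p))` (`CSSCode.zFailureProb_le_of_rowWeight`);
the erasure (`(w-1)y`) and phenomenological (`2(w+1)s`, `T` noisy rounds) companions; and the
specialisation to the bivariate-bicycle codes of Bravyi et al. (`IsBBPoly`: `A`, `B` sums of three monomials,
so every `X`-check has weight `≤ 6`, `BB.card_rowSupp_HX_le`): for EVERY such code with distance `d`,
`P_fail ≤ 2ℓm · (10 s)^d / (5 (1 - 10 s))` (`BB.zFailureProb_le`), phenomenological
`P_fail ≤ 3ℓm T · (14 s)^d / (7 (1 - 14 s))` (`BB.zPhenomFailureProb_le`), erasures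
`≤ 2ℓm (5y)^d / (5(1 - 5y))` (`BB.zErasureProb_le`); and the `X`-sector twins (`H^Z = [Bᵀ|Aᵀ]` also has
row weight `≤ 6`, `BB.card_rowSupp_HZ_le`; `d^X = d`): `CSSCode.x…_of_rowWeight`, `BB.xFailureProb_le`,
`BB.xErasureProb_le`, `BB.xPhenomFailureProb_le`. Instances with a certified `d` (e.g. `[[144,12,12]]`) are
Summits-side one-liners.

## References

* [DumerKovalevPryadko2015] I. Dumer, A. A. Kovalev, L. P. Pryadko, PRL 115 (2015) 050502, Thm 2,
  eqs. (min-E-condition), (upper-bound-Nm-CSS), p. 5 (w → w + 2).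
* [BravyiEtAl2024] S. Bravyi et al., Nature 627 (2024) 778, §4 (`H^X = [A|B]`, `A = A₁ + A₂ + A₃`).
-/

namespace Literature.InformationTheory.QuantumCodes

open Finset Matrix Filter Topology

/-! ### One CSS code, one error type -/

namespace CSSCode

variable {RX RZ Q : Type*} [Fintype Q] [DecidableEq Q]

open Classical in
/-- **Finite-size code-capacity bound** (DKP15, one code, `Z`-errors): checks `H^X` of weight `≤ w`
(`w ≥ 2`), `d^Z ≥ 1`, every minimum-weight `Z`-decoder, independent errors of rate `0 ≤ p ≤ 1/2` with
`r = 2(w-1)√(p(1-p)) < 1`: `P_fail ≤ n r^{d^Z} / ((w-1)(1-r))`.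
[cite: DumerKovalevPryadko2015, Thm 2 (y = 0) with eq. (upper-bound-Nm-CSS)] -/
theorem zFailureProb_le_of_rowWeight [Fintype RX] [Fintype RZ] (C : CSSCode RX RZ Q)
    {D : Decoder (RX → ZMod 2) (Q → ZMod 2)}
    (hD : D.IsMinWeight C.zSyndrome (C.kerX : Set (Q → ZMod 2)) hammingNorm)
    {w : ℕ} (hw : 2 ≤ w) (hrow : ∀ i, (rowSupp C.HX i).card ≤ w) (hd1 : 1 ≤ C.dZ)
    {p : ℝ} (hp0 : 0 ≤ p) (hp : p ≤ 1 / 2) (hr : 2 * ((w - 1 : ℕ) : ℝ) * Real.sqrt (p * (1 - p)) < 1) :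
    ∑ e ∈ univ.filter (fun e : Q → ZMod 2 => ¬ D.Corrects C.zSyndrome (C.rowSpZ : Set (Q → ZMod 2)) e),
        bernoulliWeight p (supp e) ≤
      (Fintype.card Q : ℝ) * (2 * ((w - 1 : ℕ) : ℝ) * Real.sqrt (p * (1 - p))) ^ C.dZ /
        (((w - 1 : ℕ) : ℝ) * (1 - 2 * ((w - 1 : ℕ) : ℝ) * Real.sqrt (p * (1 - p)))) := by
  have hD' : D.IsMinWeight (fun e => C.HX *ᵥ e) {x | C.HX *ᵥ x = 0} hammingNorm := hD
  exact sum_not_corrects_bernoulli_le_of_rowWeight C.HX C.rowSpZ hD' hw hrow hd1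
    (fun _ hx hxS => C.dZ_le_hammingNorm hx hxS) hp0 hp hr

/-- **Finite-size erasure bound** (DKP15, one code, `Z`-sector): the probability that an independent erasure
pattern of rate `y` is uncorrectable is `≤ n ((w-1)y)^{d^Z} / ((w-1)(1-(w-1)y))`.
[cite: DumerKovalevPryadko2015, Thm 2 (erasure part) with eq. (upper-bound-Nm-CSS)] -/
theorem zErasureProb_le_of_rowWeight [Fintype RX] [Fintype RZ] (C : CSSCode RX RZ Q)
    {w : ℕ} (hw : 2 ≤ w) (hrow : ∀ i, (rowSupp C.HX i).card ≤ w) (hd1 : 1 ≤ C.dZ)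
    {y : ℝ} (hy0 : 0 ≤ y) (hy1 : y ≤ 1) (hr : ((w - 1 : ℕ) : ℝ) * y < 1) :
    ErasureDecoder.uncorrectableProb {x : Q → ZMod 2 | C.HX *ᵥ x = 0} (C.rowSpZ : Set (Q → ZMod 2)) y ≤
      (Fintype.card Q : ℝ) * (((w - 1 : ℕ) : ℝ) * y) ^ C.dZ /
        (((w - 1 : ℕ) : ℝ) * (1 - ((w - 1 : ℕ) : ℝ) * y)) :=
  uncorrectableProb_le C.HX C.rowSpZ hw hrow hd1 (fun _ hx hxS => C.dZ_le_hammingNorm hx hxS) hy0 hy1 hr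

/-- **Finite-size phenomenological bound** (`q = p`, `T` noisy rounds, one code, `Z`-sector): every
minimum-weight space-time decoder has `P_fail ≤ (n + r_X) T · (2(w+1)s)^{d^Z} / ((w+1)(1 - 2(w+1)s))`.
[cite: DumerKovalevPryadko2015, Thm 3 with p. 5 (w → w + 2)] -/
theorem zPhenomFailureProb_le_of_rowWeight [Fintype RX] [DecidableEq RX] [Fintype RZ] (C : CSSCode RX RZ Q)
    (T : ℕ) {D : CSSPhenom.STDecoder RX Q T}
    (hD : D.IsMinWeight (CSSPhenom.stSyn C.HX T) (CSSPhenom.stCycles C.HX T) hammingNorm)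
    {w : ℕ} (hrow : ∀ i, (rowSupp C.HX i).card ≤ w) (hd1 : 1 ≤ C.dZ)
    {p : ℝ} (hp0 : 0 ≤ p) (hp : p ≤ 1 / 2) (hr : 2 * ((w + 1 : ℕ) : ℝ) * Real.sqrt (p * (1 - p)) < 1) :
    CSSPhenom.phenomFailureProb C.HX T (C.rowSpZ : Set (Q → ZMod 2)) D p p ≤
      (((Fintype.card Q + Fintype.card RX) * T : ℕ) : ℝ) *
          (2 * ((w + 1 : ℕ) : ℝ) * Real.sqrt (p * (1 - p))) ^ C.dZ /
        (((w + 1 : ℕ) : ℝ) * (1 - 2 * ((w + 1 : ℕ) : ℝ) * Real.sqrt (p * (1 - p)))) :=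
  CSSPhenom.phenomFailureProb_le_of_rowWeight C.rowSpZ hD hrow hd1
    (fun _ hx hxS => C.dZ_le_hammingNorm hx hxS) hp0 hp hr

open Classical in
/-- **`X`-sector, code capacity** (the same bound with `H^Z`, `xSyndrome`, `rs H^X`, `d^X`): checks `H^Z` of
weight `≤ w`, every minimum-weight `X`-decoder: `P_fail ≤ n r^{d^X} / ((w-1)(1-r))`, `r = 2(w-1)√(p(1-p))`.
[cite: DumerKovalevPryadko2015, Thm 2 (y = 0; the X/Z-symmetric statement) with eq. (upper-bound-Nm-CSS)] -/
theorem xFailureProb_le_of_rowWeight [Fintype RX] [Fintype RZ] (C : CSSCode RX RZ Q)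
    {D : Decoder (RZ → ZMod 2) (Q → ZMod 2)}
    (hD : D.IsMinWeight C.xSyndrome (C.kerZ : Set (Q → ZMod 2)) hammingNorm)
    {w : ℕ} (hw : 2 ≤ w) (hrow : ∀ i, (rowSupp C.HZ i).card ≤ w) (hd1 : 1 ≤ C.dX)
    {p : ℝ} (hp0 : 0 ≤ p) (hp : p ≤ 1 / 2) (hr : 2 * ((w - 1 : ℕ) : ℝ) * Real.sqrt (p * (1 - p)) < 1) :
    ∑ e ∈ univ.filter (fun e : Q → ZMod 2 => ¬ D.Corrects C.xSyndrome (C.rowSpX : Set (Q → ZMod 2)) e),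
        bernoulliWeight p (supp e) ≤
      (Fintype.card Q : ℝ) * (2 * ((w - 1 : ℕ) : ℝ) * Real.sqrt (p * (1 - p))) ^ C.dX /
        (((w - 1 : ℕ) : ℝ) * (1 - 2 * ((w - 1 : ℕ) : ℝ) * Real.sqrt (p * (1 - p)))) := by
  have hD' : D.IsMinWeight (fun e => C.HZ *ᵥ e) {x | C.HZ *ᵥ x = 0} hammingNorm := hD
  exact sum_not_corrects_bernoulli_le_of_rowWeight C.HZ C.rowSpX hD' hw hrow hd1
    (fun _ hx hxS => C.dX_le_hammingNorm hx hxS) hp0 hp hr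

/-- **`X`-sector, erasures**: `≤ n ((w-1)y)^{d^X} / ((w-1)(1-(w-1)y))`.
[cite: DumerKovalevPryadko2015, Thm 2 (erasure part) with eq. (upper-bound-Nm-CSS)] -/
theorem xErasureProb_le_of_rowWeight [Fintype RX] [Fintype RZ] (C : CSSCode RX RZ Q)
    {w : ℕ} (hw : 2 ≤ w) (hrow : ∀ i, (rowSupp C.HZ i).card ≤ w) (hd1 : 1 ≤ C.dX)
    {y : ℝ} (hy0 : 0 ≤ y) (hy1 : y ≤ 1) (hr : ((w - 1 : ℕ) : ℝ) * y < 1) :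
    ErasureDecoder.uncorrectableProb {x : Q → ZMod 2 | C.HZ *ᵥ x = 0} (C.rowSpX : Set (Q → ZMod 2)) y ≤
      (Fintype.card Q : ℝ) * (((w - 1 : ℕ) : ℝ) * y) ^ C.dX /
        (((w - 1 : ℕ) : ℝ) * (1 - ((w - 1 : ℕ) : ℝ) * y)) :=
  uncorrectableProb_le C.HZ C.rowSpX hw hrow hd1 (fun _ hx hxS => C.dX_le_hammingNorm hx hxS) hy0 hy1 hr

/-- **`X`-sector, noisy measurement** (`q = p`, `T` rounds of noisy `Z`-check measurement):
`P_fail ≤ (n + r_Z) T · (2(w+1)s)^{d^X} / ((w+1)(1 - 2(w+1)s))`.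
[cite: DumerKovalevPryadko2015, Thm 3 with p. 5 (w → w + 2)] -/
theorem xPhenomFailureProb_le_of_rowWeight [Fintype RX] [Fintype RZ] [DecidableEq RZ] (C : CSSCode RX RZ Q)
    (T : ℕ) {D : CSSPhenom.STDecoder RZ Q T}
    (hD : D.IsMinWeight (CSSPhenom.stSyn C.HZ T) (CSSPhenom.stCycles C.HZ T) hammingNorm)
    {w : ℕ} (hrow : ∀ i, (rowSupp C.HZ i).card ≤ w) (hd1 : 1 ≤ C.dX)
    {p : ℝ} (hp0 : 0 ≤ p) (hp : p ≤ 1 / 2) (hr : 2 * ((w + 1 : ℕ) : ℝ) * Real.sqrt (p * (1 - p)) < 1) :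
    CSSPhenom.phenomFailureProb C.HZ T (C.rowSpX : Set (Q → ZMod 2)) D p p ≤
      (((Fintype.card Q + Fintype.card RZ) * T : ℕ) : ℝ) *
          (2 * ((w + 1 : ℕ) : ℝ) * Real.sqrt (p * (1 - p))) ^ C.dX /
        (((w + 1 : ℕ) : ℝ) * (1 - 2 * ((w + 1 : ℕ) : ℝ) * Real.sqrt (p * (1 - p)))) :=
  CSSPhenom.phenomFailureProb_le_of_rowWeight C.rowSpX hD hrow hd1
    (fun _ hx hxS => C.dX_le_hammingNorm hx hxS) hp0 hp hr

/-- **`Z`-sector, LOSSES AND ERRORS** (erasures `y`, flips `p`, every minimum-weight-outside-the-erasure decoder):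
`P_fail ≤ n ((w-1)Υ)^{d^Z} / ((w-1)(1-(w-1)Υ))`, `Υ = y + 2(1-y)√(p(1-p))`.
[cite: DumerKovalevPryadko2015, Thm 2 (with App. A §1.1) and eq. (upper-bound-Nm-CSS)] -/
theorem zMixedFailureProb_le_of_rowWeight [Fintype RX] [Fintype RZ] (C : CSSCode RX RZ Q)
    {D : ErasureDecoder Q (RX → ZMod 2)} (hD : D.IsMinWeightOutside C.HX)
    {w : ℕ} (hw : 2 ≤ w) (hrow : ∀ i, (rowSupp C.HX i).card ≤ w) (hd1 : 1 ≤ C.dZ)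
    {y p : ℝ} (hy0 : 0 ≤ y) (hy1 : y ≤ 1) (hp0 : 0 ≤ p) (hp : p ≤ 1 / 2)
    (hr : ((w - 1 : ℕ) : ℝ) * upsilonCSS y p < 1) :
    mixedFailureProb C.HX (C.rowSpZ : Set (Q → ZMod 2)) D y p ≤
      (Fintype.card Q : ℝ) * (((w - 1 : ℕ) : ℝ) * upsilonCSS y p) ^ C.dZ /
        (((w - 1 : ℕ) : ℝ) * (1 - ((w - 1 : ℕ) : ℝ) * upsilonCSS y p)) :=
  mixedFailureProb_le C.HX C.rowSpZ hD hw hrow hd1 (fun _ hx hxS => C.dZ_le_hammingNorm hx hxS)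
    hy0 hy1 hp0 hp hr

end CSSCode

/-! ### Bivariate-bicycle codes: check weight `6` -/

namespace BB

variable {ℓ m : ℕ} [NeZero ℓ] [NeZero m]

/-- A three-term polynomial takes a non-zero value only at its three monomials.
[cite: BravyiEtAl2024, §4 ("A = A₁ + A₂ + A₃ … each matrix Aᵢ and Bⱼ is a power of x or y")] -/
theorem mem_of_isBBPoly_ne_zero {p : Poly ℓ m} (hp : IsBBPoly p) :
    ∃ S : Finset (Mono ℓ m), S.card ≤ 3 ∧ ∀ g, p g ≠ 0 → g ∈ S := by
  classical
  obtain ⟨g₁, g₂, g₃, -, -, -, -, rfl⟩ := hp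
  refine ⟨{g₁, g₂, g₃}, ?_, fun g hg => ?_⟩
  · exact (card_insert_le _ _).trans (Nat.succ_le_succ ((card_insert_le _ _).trans (by simp)))
  · by_contra hmem
    simp only [Finset.mem_insert, Finset.mem_singleton, not_or] at hmem
    apply hg
    simp only [Pi.add_apply, monomial, Prod.mk.eta]
    rw [Pi.single_eq_of_ne hmem.1, Pi.single_eq_of_ne hmem.2.1, Pi.single_eq_of_ne hmem.2.2, add_zero,
      add_zero]

/-- **Every `X`-check of a bivariate-bicycle code involves at most `6` qubits** (`3` in the left block from
`A = A₁ + A₂ + A₃`, `3` in the right block from `B`).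
[cite: BravyiEtAl2024, §4 ("each check … acts on six data qubits"; H^X = [A|B])] -/
theorem card_rowSupp_HX_le (C : Code ℓ m) (hA : IsBBPoly C.A) (hB : IsBBPoly C.B) (i : Mono ℓ m) :
    (rowSupp C.HX i).card ≤ 6 := by
  classical
  obtain ⟨SA, hSA, hA'⟩ := mem_of_isBBPoly_ne_zero hA
  obtain ⟨SB, hSB, hB'⟩ := mem_of_isBBPoly_ne_zero hB
  have hsub : rowSupp C.HX i ⊆
      (SA.image fun g => (Sum.inl (i + g) : Mono ℓ m ⊕ Mono ℓ m)) ∪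
        SB.image fun g => (Sum.inr (i + g) : Mono ℓ m ⊕ Mono ℓ m) := by
    intro q hq
    simp only [rowSupp, mem_filter, mem_univ, true_and] at hq
    rw [mem_union, mem_image, mem_image]
    rcases q with j | j
    · left
      rw [Code.HX_eq, fromCols_apply_inl, toMatrix_apply] at hq
      exact ⟨j - i, hA' _ hq, by rw [add_sub_cancel]⟩
    · right
      rw [Code.HX_eq, fromCols_apply_inr, toMatrix_apply] at hq
      exact ⟨j - i, hB' _ hq, by rw [add_sub_cancel]⟩
  calc (rowSupp C.HX i).card
      ≤ ((SA.image fun g => (Sum.inl (i + g) : Mono ℓ m ⊕ Mono ℓ m)) ∪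
          SB.image fun g => (Sum.inr (i + g) : Mono ℓ m ⊕ Mono ℓ m)).card := card_le_card hsub
    _ ≤ (SA.image fun g => (Sum.inl (i + g) : Mono ℓ m ⊕ Mono ℓ m)).card +
          (SB.image fun g => (Sum.inr (i + g) : Mono ℓ m ⊕ Mono ℓ m)).card := card_union_le _ _
    _ ≤ SA.card + SB.card := Nat.add_le_add card_image_le card_image_le
    _ ≤ 3 + 3 := Nat.add_le_add hSA hSB

/-- `n = 2ℓm` as the cardinality of the qubit index type. [cite: BravyiEtAl2024, Lemma 1 (n = 2ℓm)] -/
theorem card_qubits (ℓ m : ℕ) : Fintype.card (Mono ℓ m ⊕ Mono ℓ m) = 2 * ℓ * m := by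
  simp only [Fintype.card_sum, Fintype.card_prod, Fintype.card_fin]
  ring

/-- `ℓm` checks of each type. [cite: BravyiEtAl2024, §4 (H^X has ℓm rows)] -/
theorem card_checks (ℓ m : ℕ) : Fintype.card (Mono ℓ m) = ℓ * m := by
  simp only [Fintype.card_prod, Fintype.card_fin]

open Classical in
/-- **Finite-size logical-error bound for every bivariate-bicycle code** (`Z`-errors, code capacity, EVERY
minimum-weight decoder): with `d = d(QC(A,B)) ≥ 1` and `s = √(p(1-p))`, `10 s < 1`,
`P_fail ≤ 2ℓm · (10 s)^d / (5 (1 - 10 s))` — Dumer–Kovalev–Pryadko's bound at check weight `6`.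
[cite: DumerKovalevPryadko2015, Thm 2 (y = 0) with eq. (upper-bound-Nm-CSS) (w = 6)] -/
theorem zFailureProb_le (C : Code ℓ m) (hA : IsBBPoly C.A) (hB : IsBBPoly C.B)
    {D : Decoder (Mono ℓ m → ZMod 2) (Mono ℓ m ⊕ Mono ℓ m → ZMod 2)}
    (hD : D.IsMinWeight C.css.zSyndrome (C.css.kerX : Set (Mono ℓ m ⊕ Mono ℓ m → ZMod 2)) hammingNorm)
    (hd1 : 1 ≤ C.d) {p : ℝ} (hp0 : 0 ≤ p) (hp : p ≤ 1 / 2) (hr : 10 * Real.sqrt (p * (1 - p)) < 1) :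
    ∑ e ∈ univ.filter (fun e : Mono ℓ m ⊕ Mono ℓ m → ZMod 2 =>
        ¬ D.Corrects C.css.zSyndrome (C.css.rowSpZ : Set (Mono ℓ m ⊕ Mono ℓ m → ZMod 2)) e),
        bernoulliWeight p (supp e) ≤
      (2 * ℓ * m : ℕ) * (10 * Real.sqrt (p * (1 - p))) ^ C.d / (5 * (1 - 10 * Real.sqrt (p * (1 - p)))) := by
  have hd1' : 1 ≤ C.css.dZ := by rwa [← Code.d_eq_dZ]
  have hr' : 2 * ((6 - 1 : ℕ) : ℝ) * Real.sqrt (p * (1 - p)) < 1 := by norm_num; linarith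
  have h := C.css.zFailureProb_le_of_rowWeight hD (w := 6) (by norm_num)
    (fun i => card_rowSupp_HX_le C hA hB i) hd1' hp0 hp hr'
  rw [card_qubits, ← Code.d_eq_dZ] at h
  refine h.trans (le_of_eq ?_)
  have h5 : ((6 - 1 : ℕ) : ℝ) = 5 := by norm_num
  rw [h5]
  ring

/-- **Finite-size erasure bound for every bivariate-bicycle code** (`Z`-sector): the probability that an
independent erasure pattern of rate `0 ≤ y < 1/5` is uncorrectable is `≤ 2ℓm (5y)^d / (5(1-5y))`.
[cite: DumerKovalevPryadko2015, Thm 2 (erasure part, w = 6)] -/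
theorem zErasureProb_le (C : Code ℓ m) (hA : IsBBPoly C.A) (hB : IsBBPoly C.B) (hd1 : 1 ≤ C.d)
    {y : ℝ} (hy0 : 0 ≤ y) (hy : 5 * y < 1) :
    ErasureDecoder.uncorrectableProb {x : Mono ℓ m ⊕ Mono ℓ m → ZMod 2 | C.HX *ᵥ x = 0}
        (C.css.rowSpZ : Set (Mono ℓ m ⊕ Mono ℓ m → ZMod 2)) y ≤
      (2 * ℓ * m : ℕ) * (5 * y) ^ C.d / (5 * (1 - 5 * y)) := by
  have hd1' : 1 ≤ C.css.dZ := by rwa [← Code.d_eq_dZ]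
  have hy1 : y ≤ 1 := by linarith
  have hr' : ((6 - 1 : ℕ) : ℝ) * y < 1 := by norm_num; linarith
  have h := C.css.zErasureProb_le_of_rowWeight (w := 6) (by norm_num) (fun i => card_rowSupp_HX_le C hA hB i)
    hd1' hy0 hy1 hr'
  rw [card_qubits, ← Code.d_eq_dZ] at h
  refine (le_of_eq (by rfl)).trans (h.trans (le_of_eq ?_))
  have h5 : ((6 - 1 : ℕ) : ℝ) = 5 := by norm_num
  rw [h5]

/-- **Finite-size phenomenological bound for every bivariate-bicycle code** (`Z`-sector, `q = p`, `T` noisy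
rounds, EVERY minimum-weight space-time decoder): `P_fail ≤ 3ℓmT · (14 s)^d / (7 (1 - 14 s))`.
[cite: DumerKovalevPryadko2015, Thm 3 with p. 5 (w → w + 2; here 6 → 8)] -/
theorem zPhenomFailureProb_le (C : Code ℓ m) (hA : IsBBPoly C.A) (hB : IsBBPoly C.B) (T : ℕ)
    {D : CSSPhenom.STDecoder (Mono ℓ m) (Mono ℓ m ⊕ Mono ℓ m) T}
    (hD : D.IsMinWeight (CSSPhenom.stSyn C.HX T) (CSSPhenom.stCycles C.HX T) hammingNorm)
    (hd1 : 1 ≤ C.d) {p : ℝ} (hp0 : 0 ≤ p) (hp : p ≤ 1 / 2) (hr : 14 * Real.sqrt (p * (1 - p)) < 1) :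
    CSSPhenom.phenomFailureProb C.HX T (C.css.rowSpZ : Set (Mono ℓ m ⊕ Mono ℓ m → ZMod 2)) D p p ≤
      (3 * ℓ * m * T : ℕ) * (14 * Real.sqrt (p * (1 - p))) ^ C.d /
        (7 * (1 - 14 * Real.sqrt (p * (1 - p)))) := by
  have hd1' : 1 ≤ C.css.dZ := by rwa [← Code.d_eq_dZ]
  have hr' : 2 * ((6 + 1 : ℕ) : ℝ) * Real.sqrt (p * (1 - p)) < 1 := by norm_num; linarith
  have h := C.css.zPhenomFailureProb_le_of_rowWeight T hD (w := 6) (fun i => card_rowSupp_HX_le C hA hB i)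
    hd1' hp0 hp hr'
  rw [← Code.d_eq_dZ] at h
  refine h.trans (le_of_eq ?_)
  have hcard : ((Fintype.card (Mono ℓ m ⊕ Mono ℓ m) + Fintype.card (Mono ℓ m)) * T : ℕ) = 3 * ℓ * m * T := by
    rw [card_qubits, card_checks]
    ring
  rw [hcard]
  have h7 : ((6 + 1 : ℕ) : ℝ) = 7 := by norm_num
  rw [h7]
  ring

/-- **Every `Z`-check of a bivariate-bicycle code involves at most `6` qubits** (`H^Z = [Bᵀ | Aᵀ]`: `3`
from the column of `B`, `3` from the column of `A`).
[cite: BravyiEtAl2024, §4 ("each check … acts on six data qubits"; H^Z = [B^T|A^T])] -/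
theorem card_rowSupp_HZ_le (C : Code ℓ m) (hA : IsBBPoly C.A) (hB : IsBBPoly C.B) (i : Mono ℓ m) :
    (rowSupp C.HZ i).card ≤ 6 := by
  classical
  obtain ⟨SA, hSA, hA'⟩ := mem_of_isBBPoly_ne_zero hA
  obtain ⟨SB, hSB, hB'⟩ := mem_of_isBBPoly_ne_zero hB
  have hsub : rowSupp C.HZ i ⊆
      (SB.image fun g => (Sum.inl (i - g) : Mono ℓ m ⊕ Mono ℓ m)) ∪
        SA.image fun g => (Sum.inr (i - g) : Mono ℓ m ⊕ Mono ℓ m) := by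
    intro q hq
    simp only [rowSupp, mem_filter, mem_univ, true_and] at hq
    rw [mem_union, mem_image, mem_image]
    rcases q with j | j
    · left
      rw [Code.HZ_eq, fromCols_apply_inl, transpose_apply, toMatrix_apply] at hq
      exact ⟨i - j, hB' _ hq, by rw [sub_sub_cancel]⟩
    · right
      rw [Code.HZ_eq, fromCols_apply_inr, transpose_apply, toMatrix_apply] at hq
      exact ⟨i - j, hA' _ hq, by rw [sub_sub_cancel]⟩
  calc (rowSupp C.HZ i).card
      ≤ ((SB.image fun g => (Sum.inl (i - g) : Mono ℓ m ⊕ Mono ℓ m)) ∪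
          SA.image fun g => (Sum.inr (i - g) : Mono ℓ m ⊕ Mono ℓ m)).card := card_le_card hsub
    _ ≤ (SB.image fun g => (Sum.inl (i - g) : Mono ℓ m ⊕ Mono ℓ m)).card +
          (SA.image fun g => (Sum.inr (i - g) : Mono ℓ m ⊕ Mono ℓ m)).card := card_union_le _ _
    _ ≤ SB.card + SA.card := Nat.add_le_add card_image_le card_image_le
    _ ≤ 3 + 3 := Nat.add_le_add hSB hSA

open Classical in
/-- **`X`-errors of a bivariate-bicycle code, code capacity** (every minimum-weight `X`-decoder):
`P_fail ≤ 2ℓm · (10 s)^d / (5 (1 - 10 s))` (`d^X = d`, Lemma 1).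
[cite: DumerKovalevPryadko2015, Thm 2 (y = 0, w = 6)] -/
theorem xFailureProb_le (C : Code ℓ m) (hA : IsBBPoly C.A) (hB : IsBBPoly C.B)
    {D : Decoder (Mono ℓ m → ZMod 2) (Mono ℓ m ⊕ Mono ℓ m → ZMod 2)}
    (hD : D.IsMinWeight C.css.xSyndrome (C.css.kerZ : Set (Mono ℓ m ⊕ Mono ℓ m → ZMod 2)) hammingNorm)
    (hd1 : 1 ≤ C.d) {p : ℝ} (hp0 : 0 ≤ p) (hp : p ≤ 1 / 2) (hr : 10 * Real.sqrt (p * (1 - p)) < 1) :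
    ∑ e ∈ univ.filter (fun e : Mono ℓ m ⊕ Mono ℓ m → ZMod 2 =>
        ¬ D.Corrects C.css.xSyndrome (C.css.rowSpX : Set (Mono ℓ m ⊕ Mono ℓ m → ZMod 2)) e),
        bernoulliWeight p (supp e) ≤
      (2 * ℓ * m : ℕ) * (10 * Real.sqrt (p * (1 - p))) ^ C.d / (5 * (1 - 10 * Real.sqrt (p * (1 - p)))) := by
  have hd1' : 1 ≤ C.css.dX := by rwa [← Code.d_eq_dX]
  have hr' : 2 * ((6 - 1 : ℕ) : ℝ) * Real.sqrt (p * (1 - p)) < 1 := by norm_num; linarith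
  have h := C.css.xFailureProb_le_of_rowWeight hD (w := 6) (by norm_num)
    (fun i => card_rowSupp_HZ_le C hA hB i) hd1' hp0 hp hr'
  rw [card_qubits, ← Code.d_eq_dX] at h
  refine h.trans (le_of_eq ?_)
  have h5 : ((6 - 1 : ℕ) : ℝ) = 5 := by norm_num
  rw [h5]
  ring

/-- **`X`-sector erasure bound for every bivariate-bicycle code**: `≤ 2ℓm (5y)^d / (5(1-5y))`.
[cite: DumerKovalevPryadko2015, Thm 2 (erasure part, w = 6)] -/
theorem xErasureProb_le (C : Code ℓ m) (hA : IsBBPoly C.A) (hB : IsBBPoly C.B) (hd1 : 1 ≤ C.d)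
    {y : ℝ} (hy0 : 0 ≤ y) (hy : 5 * y < 1) :
    ErasureDecoder.uncorrectableProb {x : Mono ℓ m ⊕ Mono ℓ m → ZMod 2 | C.HZ *ᵥ x = 0}
        (C.css.rowSpX : Set (Mono ℓ m ⊕ Mono ℓ m → ZMod 2)) y ≤
      (2 * ℓ * m : ℕ) * (5 * y) ^ C.d / (5 * (1 - 5 * y)) := by
  have hd1' : 1 ≤ C.css.dX := by rwa [← Code.d_eq_dX]
  have hy1 : y ≤ 1 := by linarith
  have hr' : ((6 - 1 : ℕ) : ℝ) * y < 1 := by norm_num; linarith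
  have h := C.css.xErasureProb_le_of_rowWeight (w := 6) (by norm_num) (fun i => card_rowSupp_HZ_le C hA hB i)
    hd1' hy0 hy1 hr'
  rw [card_qubits, ← Code.d_eq_dX] at h
  refine (le_of_eq (by rfl)).trans (h.trans (le_of_eq ?_))
  have h5 : ((6 - 1 : ℕ) : ℝ) = 5 := by norm_num
  rw [h5]

/-- **`X`-sector phenomenological bound for every bivariate-bicycle code** (`T` rounds of noisy `Z`-check
measurement, `q = p`): `P_fail ≤ 3ℓmT · (14 s)^d / (7 (1 - 14 s))`.
[cite: DumerKovalevPryadko2015, Thm 3 with p. 5 (w → w + 2)] -/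
theorem xPhenomFailureProb_le (C : Code ℓ m) (hA : IsBBPoly C.A) (hB : IsBBPoly C.B) (T : ℕ)
    {D : CSSPhenom.STDecoder (Mono ℓ m) (Mono ℓ m ⊕ Mono ℓ m) T}
    (hD : D.IsMinWeight (CSSPhenom.stSyn C.HZ T) (CSSPhenom.stCycles C.HZ T) hammingNorm)
    (hd1 : 1 ≤ C.d) {p : ℝ} (hp0 : 0 ≤ p) (hp : p ≤ 1 / 2) (hr : 14 * Real.sqrt (p * (1 - p)) < 1) :
    CSSPhenom.phenomFailureProb C.HZ T (C.css.rowSpX : Set (Mono ℓ m ⊕ Mono ℓ m → ZMod 2)) D p p ≤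
      (3 * ℓ * m * T : ℕ) * (14 * Real.sqrt (p * (1 - p))) ^ C.d /
        (7 * (1 - 14 * Real.sqrt (p * (1 - p)))) := by
  have hd1' : 1 ≤ C.css.dX := by rwa [← Code.d_eq_dX]
  have hr' : 2 * ((6 + 1 : ℕ) : ℝ) * Real.sqrt (p * (1 - p)) < 1 := by norm_num; linarith
  have h := C.css.xPhenomFailureProb_le_of_rowWeight T hD (w := 6) (fun i => card_rowSupp_HZ_le C hA hB i)
    hd1' hp0 hp hr'
  rw [← Code.d_eq_dX] at h
  refine h.trans (le_of_eq ?_)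
  have hcard : ((Fintype.card (Mono ℓ m ⊕ Mono ℓ m) + Fintype.card (Mono ℓ m)) * T : ℕ) = 3 * ℓ * m * T := by
    rw [card_qubits, card_checks]
    ring
  rw [hcard]
  have h7 : ((6 + 1 : ℕ) : ℝ) = 7 := by norm_num
  rw [h7]
  ring

/-- **LOSSES AND ERRORS for every bivariate-bicycle code** (`Z`-sector, every minimum-weight-outside-the-erasure
decoder): `P_fail ≤ 2ℓm (5Υ)^d / (5 (1 - 5Υ))`, `Υ = y + 2(1-y)√(p(1-p))`, `5Υ < 1`.
[cite: DumerKovalevPryadko2015, Thm 2 (w = 6) with App. A §1.1] -/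
theorem zMixedFailureProb_le (C : Code ℓ m) (hA : IsBBPoly C.A) (hB : IsBBPoly C.B)
    {D : ErasureDecoder (Mono ℓ m ⊕ Mono ℓ m) (Mono ℓ m → ZMod 2)} (hD : D.IsMinWeightOutside C.HX)
    (hd1 : 1 ≤ C.d) {y p : ℝ} (hy0 : 0 ≤ y) (hy1 : y ≤ 1) (hp0 : 0 ≤ p) (hp : p ≤ 1 / 2)
    (hr : 5 * upsilonCSS y p < 1) :
    mixedFailureProb C.HX (C.css.rowSpZ : Set (Mono ℓ m ⊕ Mono ℓ m → ZMod 2)) D y p ≤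
      (2 * ℓ * m : ℕ) * (5 * upsilonCSS y p) ^ C.d / (5 * (1 - 5 * upsilonCSS y p)) := by
  have hd1' : 1 ≤ C.css.dZ := by rwa [← Code.d_eq_dZ]
  have hr' : ((6 - 1 : ℕ) : ℝ) * upsilonCSS y p < 1 := by norm_num; linarith
  have h := C.css.zMixedFailureProb_le_of_rowWeight hD (w := 6) (by norm_num)
    (fun i => card_rowSupp_HX_le C hA hB i) hd1' hy0 hy1 hp0 hp hr'
  rw [card_qubits, ← Code.d_eq_dZ] at h
  refine (le_of_eq (by rfl)).trans (h.trans (le_of_eq ?_))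
  have h5 : ((6 - 1 : ℕ) : ℝ) = 5 := by norm_num
  rw [h5]

end BB

end Literature.InformationTheory.QuantumCodes
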